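import Mathlib

/-!
# STUB-IDEAS k2 (gen 45) — literature transfer, typed dictionary: the TWIN θ-ELEMENT reading of
# road δ (Kohen–Pacetti 2018 §4 «the good reduction twist case» ↦ `W = A′ ⊗ χ_ε` at the split additive 2)

HONEST FRAMING. BSD is NOT proved here; the crux `SplitBadTwoLowerHalfOfFacts` and the stub
`stub_heegnerIndexLowerAtTwo` are NOT proved here; nothing in this file is a named fact, a route item
or a proposal. Gate-evidence sketch only (crux `stmt-BirchSwinnertonDyer-27851`, cell bsd-print-cf2).

WHAT IS DECIDED HERE (kernel, `decide`): the dyadic digits of the SHIFT CHARACTER `χ̃_ε := χ_ε ∘ N_{K/ℚ}`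
restricted to the split local units `(𝒪_K ⊗ ℤ₂)ˣ = ℤ₂ˣ × ℤ₂ˣ`, `χ̃_ε(x, y) = χ_ε(x·y)`:
* §1 its CONDUCTOR EXPONENT `n(ε)`: `χ_ε(x·y) = 1` whenever `x ≡ y (mod 2^{n(ε)})`, and this fails
  `mod 2^{n(ε)-1}` — `n(−1) = 2`, `n(±2) = 3` (this is the plan's `n(key)`, re-derived as the ring-class
  conductor exponent of the genus character `χ̃_ε`; Mathlib's `χ₄ ↔ ℚ(√−1)`, `χ₈ ↔ ℚ(√2)`, `χ₈' ↔ ℚ(√−2)`);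
* §2 its PLACE in `ℤ₂ˣ = {±1} × (1 + 4ℤ₂)` (anticyclotomic reading `χ̃_ε(x,y) = χ_ε(x·y⁻¹)`, `5` a
  topological generator of `1 + 4ℤ₂`): `χ̃₂` lives on the `ℤ₂`-LINE (trivial on `−1`, `−1` at `5`: it is the
  first layer of the twin's anticyclotomic `ℤ₂`-tower), `χ̃₋₁` is the TORSION genus character (`−1` at `−1`,
  trivial at `5`), `χ̃₋₂` is mixed;
* §3 the isotypic lemma behind «the `χ̃_ε`-component of the twin's conductor-`2^{n(ε)}` Heegner point is a
  point of `W(K)`»: a `χ`-trace is `χ`-isotypic (abstract finite group action, `χ : G →* ℤˣ`).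
The literature dictionary these digits serve (KP2018 §4 p. 12, Thm 4.1; [B-D1] = Bertolini–Darmon 1996)
is in the companion markdown; its research residues are NAMED there, not typed here.
-/

namespace Summit.BirchSwinnertonDyer.BirchSwinnertonDyer.Cruxes.SplitBadTwoLowerHalfOfFacts.TransferK2G45

open ZMod

/-! ## §1 Conductor exponent of `χ̃_ε` on the split units: `x ≡ y (mod 2^n) ⇒ χ_ε(xy) = 1`, sharp -/

/-- `ε = −1`: on units, `x ≡ y (mod 4)` forces `χ₋₄(xy) = χ₋₄(x²) = 1` (never `−1`). -/
theorem chi4_mul_self_ne_neg_one : ∀ x : ZMod 4, χ₄ (x * x) ≠ -1 := by decide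

/-- … and `mod 2` does not suffice: `1 ≡ 3 (mod 2)` but `χ₋₄(1·3) = −1`. So `n(−1) = 2`. -/
theorem chi4_conductorExp_sharp : χ₄ ((1 : ZMod 4) * 3) = -1 := by decide

/-- `ε = 2`: on units, `x ≡ y (mod 8)` forces `χ₈(xy) = χ₈(x²) = 1` (never `−1`). -/
theorem chi8_mul_self_ne_neg_one : ∀ x : ZMod 8, χ₈ (x * x) ≠ -1 := by decide

/-- … and `mod 4` does not suffice: `1 ≡ 5 (mod 4)` but `χ₈(1·5) = −1`. So `n(2) = 3`. -/
theorem chi8_conductorExp_sharp : χ₈ ((1 : ZMod 8) * 5) = -1 ∧ (5 : ℤ) % 4 = 1 % 4 := by decide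

/-- `ε = −2`: on units, `x ≡ y (mod 8)` forces `χ₈'(xy) = 1` (never `−1`). -/
theorem chi8'_mul_self_ne_neg_one : ∀ x : ZMod 8, χ₈' (x * x) ≠ -1 := by decide

/-- … and `mod 4` does not suffice: `χ₈'(1·5) = −1`. So `n(−2) = 3`. -/
theorem chi8'_conductorExp_sharp : χ₈' ((1 : ZMod 8) * 5) = -1 ∧ (5 : ℤ) % 4 = 1 % 4 := by decide

/-- The plan's `n(key)` as a function of the local twist sign `ε ∈ {−1, 2, −2}`. -/
def conductorExp (ε : ℤ) : ℕ := if ε = -1 then 2 else 3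

theorem conductorExp_values : conductorExp (-1) = 2 ∧ conductorExp 2 = 3 ∧ conductorExp (-2) = 3 := by
  decide

/-! ## §2 Anticyclotomic placement of `χ̃_ε` in `ℤ₂ˣ = {±1} × (1 + 4ℤ₂)` (generator `5` of `1 + 4ℤ₂`) -/

/-- On units the shift character reads anticyclotomically: `χ_ε(x·y) = χ_ε(x·y⁻¹)` because unit squares
are `1 (mod 8)`; recorded as `χ(x·y) = χ(x·y·(y·y))`-invariance, all three characters. -/
theorem shift_reads_anticyclotomically :
    (∀ x y : ZMod 8, χ₈ (x * y * (y * y)) = χ₈ (x * y) ∨ χ₈ y = 0) ∧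
    (∀ x y : ZMod 8, χ₈' (x * y * (y * y)) = χ₈' (x * y) ∨ χ₈' y = 0) ∧
    (∀ x y : ZMod 4, χ₄ (x * y * (y * y)) = χ₄ (x * y) ∨ χ₄ y = 0) := by
  refine ⟨by decide, by decide, by decide⟩

/-- `χ̃₂` lies on the `ℤ₂`-LINE: trivial on the torsion `−1`, nontrivial on the generator `5` of `1+4ℤ₂`
(so `W = A′ ⊗ χ₂` is read at the FIRST LAYER of the twin's anticyclotomic `ℤ₂`-tower at `2`). -/
theorem chi8_on_line : χ₈ (-1 : ZMod 8) = 1 ∧ χ₈ (5 : ZMod 8) = -1 := by decide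

/-- `χ̃₋₁` is the TORSION genus character: nontrivial on `−1`, trivial on `1 + 4ℤ₂` (it only sees residues
`mod 4`), so it is NOT a specialisation of the twin's `ℤ₂`-line but a separate branch. -/
theorem chi4_torsion : χ₄ (-1 : ZMod 4) = -1 ∧ χ₄ ((5 : ZMod 8).cast : ZMod 4) = 1 := by decide

/-- `χ̃₋₂ = χ̃₋₁ · χ̃₂` is mixed: nontrivial on `−1` AND on `5`. -/
theorem chi8'_mixed : χ₈' (-1 : ZMod 8) = -1 ∧ χ₈' (5 : ZMod 8) = -1 := by decide

/-! ## §3 The isotypic lemma: a `χ`-trace is `χ`-isotypic (membership of the genus component in `W(K)`) -/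

section ChiTrace

variable {G A : Type*} [Group G] [Fintype G] [AddCommGroup A] [DistribMulAction G A]

/-- The `χ`-trace `Σ_h χ(h)·(h • x)` of a point under a finite group action, `χ : G →* ℤˣ` quadratic. -/
def chiTrace (χ : G →* ℤˣ) (x : A) : A := ∑ h : G, ((χ h : ℤ)) • h • x

omit [Fintype G] in
private theorem units_int_inv_eq_self (u : ℤˣ) : u⁻¹ = u :=
  inv_eq_of_mul_eq_one_right (Int.units_mul_self u)

/-- `g • P_χ = χ(g) • P_χ`: the `χ`-trace is `χ`-isotypic. With `G = Gal(H_c/K)`, `A = A′(H_c)`,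
`χ = χ̃_ε` this says the genus component `P_ε` of the twin's conductor-`c` Heegner point is fixed by
`ker χ̃_ε = Gal(H_c/K(√ε))` and anti-invariant under `Gal(K(√ε)/K)`, i.e. `P_ε ∈ A′(K(√ε))⁻ = W(K)`. -/
theorem smul_chiTrace (χ : G →* ℤˣ) (x : A) (g : G) :
    g • chiTrace χ x = ((χ g : ℤ)) • chiTrace χ x := by
  classical
  unfold chiTrace
  rw [Finset.smul_sum, Finset.smul_sum]
  -- reindex the left sum along `h ↦ g⁻¹ * h`
  rw [← Equiv.sum_comp (Equiv.mulLeft g⁻¹)]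
  refine Finset.sum_congr rfl fun h _ => ?_
  simp only [Equiv.coe_mulLeft, map_mul, map_inv, units_int_inv_eq_self, Units.val_mul]
  rw [smul_comm g, ← mul_smul g, mul_inv_cancel_left, mul_smul]

end ChiTrace

end Summit.BirchSwinnertonDyer.BirchSwinnertonDyer.Cruxes.SplitBadTwoLowerHalfOfFacts.TransferK2G45
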